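import Summits.QuantumFields.YangMills.Theorems.SwapVirialDeficitNearFlatCoaxialProjection
import Summits.QuantumFields.YangMills.Theorems.SwapVirialDeficitNearFlatBulk
import HarnessLib

/-!
# NEAR-FLAT PROJECTION WITH A HEAVY LEADER IN THE TRIPLE — END PATCHES INCLUDED: coaxialize the triple, transfer the σ-words, apply LEAD g99's `exists_flat_near_of_coax`, bridge
# (free-hands support of ⟨stmt-QuantumFields-24197⟩ `SwapVirialDeficit.SwapGluedStiffness`; the ASSEMBLY of memo7 §C(c) announced on STATUS 20:08Z/20:25Z: w3's ✓`exists_coaxial_tuple`,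
# ✓`sigma_residual_lipschitz`, ✓`flat_of_sigma_relations` around LEAD g99's ✓`exists_flat_near_of_coax` (A- and B-branches, so the END hubs `re ĉ → 0` are covered))

* ★★★ `exists_flat_near_of_heavy_triple (q) (h : Fin 3) (hh : im Ĉ_h ≠ 0) (m κ ε)`: if the three σ-residuals are `≤ m`, the commutators `‖[Ĉ_h, Ĉ_μ]‖ ≤ κ` (`μ ∈ Fin 3`) and
  `3·(m + 2κ/‖im Ĉ_h‖)² ≤ ε⁴` (`0 ≤ ε`), then there is an exactly flat `q♭` (followers `1`) with `‖Ĉ_μ − su2Quat (q♭.1 μ)‖ ≤ κ/‖im Ĉ_h‖ + 4ε` for the triple and `‖ĉ − su2Quat (q♭.1 3)‖ ≤ 4ε`.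
  With ✓`relations_le_of_chartDeficit` (`m = κ = 60L³√F/√2`) this is the Hölder-type projection on every patch with a heavy triple leader — no condition on the hub, so the END
  patches (`re ĉ → 0`, stratum B) are included; bulk hubs have the sharper ✓`exists_flat_near_bulk`, all-light triples ✓`exists_flat_near_corner` ∕ ✓`exists_flat_corner_general`.

HONEST LABEL: assembly of landed lemmas; stubs of ➎, ⟨24197⟩ ∕ ⟨24194⟩ ∕ ⟨24497⟩ OPEN; own crux ⟨22884⟩ OPEN (blocked-on ⟨19935⟩); the Yang–Mills mass gap is NOT proved; no summit is
proved by a line.  THEOREMS ONLY (0 `def`, 0 `sorry`), standard axioms.  Width seat ym-line-sfw-p2-w3 g66 (cell ym-idea-1, free hands), `--supports stmt-QuantumFields-24197`.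
References: [cite: Luscher1983, §2]; [folklore].
-/

set_option autoImplicit false

noncomputable section

open Quaternion
open scoped Quaternion RealInnerProductSpace
open Literature.MathematicalPhysics.QuantumFieldTheory hiding SU2
open Literature.MathematicalPhysics.QuantumLattice
open Literature.Analysis.Calculus (radialUnit radialUnit_def)
open Summit.QuantumFields.YangMills.Theorems.SwapVirialDeficit.ZeroModeSigma (su2Quat_quatToSU2_eq_radialUnit)

namespace Summit.QuantumFields.YangMills.Theorems.SwapVirialDeficit.NearFlat

open Summit.QuantumFields.YangMills.Theorems.FemtoTransferGap
open Summit.QuantumFields.YangMills.Theorems.FemtoTransferGap.TT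
open Summit.QuantumFields.YangMills.Theorems.VirialFluxGap.RingDeficit
open Summit.QuantumFields.YangMills.Theorems.SwapVirialDeficit.SwapRing
open Summit.QuantumFields.YangMills.Theorems.SwapVirialDeficit.BlowUpRing

variable {L : ℕ} [NeZero L]

set_option maxHeartbeats 1600000 in
/-- ★★★ **NEAR-FLAT PROJECTION WITH A HEAVY TRIPLE LEADER (end patches included).** [cite: Luscher1983, §2] -/
theorem exists_flat_near_of_heavy_triple (q : (Fin 4 → SU2) × (Fol L → SU2)) (h : Fin 3) (hh : (su2Quat (q.1 (Fin.castSucc h))).im ≠ 0)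
    {m κ ε : ℝ} (hε : 0 ≤ ε)
    (hm0 : ‖su2Quat (q.1 3) * su2Quat (q.1 1) - su2Quat (q.1 0) * su2Quat (q.1 3)‖ ≤ m)
    (hm1 : ‖su2Quat (q.1 3) * su2Quat (q.1 0) - su2Quat (q.1 1) * su2Quat (q.1 3)‖ ≤ m)
    (hm2 : ‖su2Quat (q.1 3) * su2Quat (q.1 2) - su2Quat (q.1 2) * su2Quat (q.1 3)‖ ≤ m)
    (hκ : ∀ μ : Fin 3, ‖su2Quat (q.1 (Fin.castSucc h)) * su2Quat (q.1 (Fin.castSucc μ)) - su2Quat (q.1 (Fin.castSucc μ)) * su2Quat (q.1 (Fin.castSucc h))‖ ≤ κ)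
    (hεW : 3 * (m + 2 * (κ / ‖(su2Quat (q.1 (Fin.castSucc h))).im‖)) ^ 2 ≤ ε ^ 4) :
    ∃ qf : (Fin 4 → SU2) × (Fol L → SU2), chartDeficit L (fun _ => false) (fun _ => 1) qf = 0 ∧ (∀ i, qf.2 i = 1) ∧
      (∀ μ : Fin 3, ‖su2Quat (q.1 (Fin.castSucc μ)) - su2Quat (qf.1 (Fin.castSucc μ))‖ ≤ κ / ‖(su2Quat (q.1 (Fin.castSucc h))).im‖ + 4 * ε) ∧
      ‖su2Quat (q.1 3) - su2Quat (qf.1 3)‖ ≤ 4 * ε := by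
  -- the triple, the hub, the coaxialization
  set C : Fin 3 → ℍ := fun μ => su2Quat (q.1 (Fin.castSucc μ)) with hC
  set c : ℍ := su2Quat (q.1 3) with hcdef
  have hCu : ∀ μ, ‖C μ‖ = 1 := fun μ => norm_su2Quat _
  have hcu : ‖c‖ = 1 := norm_su2Quat _
  have hhC : (C h).im ≠ 0 := hh
  obtain ⟨C', hre, hax, hnorm, -, -, hdist⟩ := exists_coaxial_tuple C h hhC
  have hN0 : 0 < ‖(C h).im‖ := norm_pos_iff.2 hhC
  set D : ℝ := κ / ‖(C h).im‖ with hD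
  have hdist' : ∀ μ, ‖C μ - C' μ‖ ≤ D := fun μ => (hdist μ).trans (div_le_div_of_nonneg_right (hκ μ) hN0.le)
  have hκ0 : 0 ≤ κ := le_trans (norm_nonneg _) (hκ h)
  have hD0 : 0 ≤ D := div_nonneg hκ0 hN0.le
  have hm0' : 0 ≤ m := le_trans (norm_nonneg _) hm2
  -- the unit axis `v` and the coax letters
  set v : ℍ := ‖(C h).im‖⁻¹ • (C h).im with hv
  have hvre : v.re = 0 := by rw [hv, Quaternion.re_smul]; simp
  have hv1 : ‖v‖ = 1 := by rw [hv, norm_smul, Real.norm_eq_abs, abs_inv, abs_norm, inv_mul_cancel₀ hN0.ne']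
  choose t ht using hax
  have eC' : ∀ μ, C' μ = (((C μ).re : ℝ) : ℍ) + (t μ * ‖(C h).im‖) • v := fun μ => by
    have e1 : C' μ = (((C' μ).re : ℝ) : ℍ) + (C' μ).im := (Quaternion.re_add_im _).symm
    rw [e1, hre μ, ht μ, hv, smul_smul, mul_assoc, mul_inv_cancel₀ hN0.ne', mul_one]
  have hunit : ∀ μ, (C μ).re ^ 2 + (t μ * ‖(C h).im‖) ^ 2 = 1 := fun μ => by
    have h1 : ‖C' μ‖ ^ 2 = 1 := by rw [hnorm μ, hCu μ, one_pow]
    rw [eC' μ, norm_sq_coe_add_pure _ (by rw [Quaternion.re_smul, hvre, smul_zero]), norm_smul, Real.norm_eq_abs, hv1, mul_one, sq_abs] at h1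
    exact h1
  -- the transferred σ-words
  have hm0C : ‖c * C 1 - C 0 * c‖ ≤ m := hm0
  have hm1C : ‖c * C 0 - C 1 * c‖ ≤ m := hm1
  have hm2C : ‖c * C 2 - C 2 * c‖ ≤ m := hm2
  have hw0 : ‖c * C' 1 - C' 0 * c‖ ≤ m + 2 * D := by
    have := sigma_residual_lipschitz hcu (C 0) (C 1) (C' 0) (C' 1); linarith [hdist' 0, hdist' 1]
  have hw1 : ‖c * C' 0 - C' 1 * c‖ ≤ m + 2 * D := by
    have := sigma_residual_lipschitz hcu (C 1) (C 0) (C' 1) (C' 0); linarith [hdist' 0, hdist' 1]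
  have hw2 : ‖c * C' 2 - C' 2 * c‖ ≤ m + 2 * D := by
    have := sigma_residual_lipschitz hcu (C 2) (C 2) (C' 2) (C' 2); linarith [hdist' 2]
  have hsq : ∀ x : ℍ, ‖x‖ ≤ m + 2 * D → ‖x‖ ^ 2 ≤ (m + 2 * D) ^ 2 := fun x hx => pow_le_pow_left₀ (norm_nonneg _) hx 2
  have hW : ‖c * ((((C 1).re : ℝ) : ℍ) + (t 1 * ‖(C h).im‖) • v) - ((((C 0).re : ℝ) : ℍ) + (t 0 * ‖(C h).im‖) • v) * c‖ ^ 2 +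
      ‖c * ((((C 0).re : ℝ) : ℍ) + (t 0 * ‖(C h).im‖) • v) - ((((C 1).re : ℝ) : ℍ) + (t 1 * ‖(C h).im‖) • v) * c‖ ^ 2 +
      ‖c * ((((C 2).re : ℝ) : ℍ) + (t 2 * ‖(C h).im‖) • v) - ((((C 2).re : ℝ) : ℍ) + (t 2 * ‖(C h).im‖) • v) * c‖ ^ 2 ≤ ε ^ 4 := by
    rw [← eC' 0, ← eC' 1, ← eC' 2]
    linarith [hsq _ hw0, hsq _ hw1, hsq _ hw2]
  -- LEAD g99's σ-word projection
  obtain ⟨c', C₀', C₁', C₂', hc', hC₀', hC₁', hC₂', h01, h02, h12, hs0, hs1, hs2, hdc, hd0, hd1, hd2⟩ :=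
    exists_flat_near_of_coax hvre hv1 hcu (hunit 0) (hunit 1) (hunit 2) hε hW
  rw [← eC' 0] at hd0
  rw [← eC' 1] at hd1
  rw [← eC' 2] at hd2
  -- the flat quadruple and the bridge
  set Cf : Fin 4 → ℍ := ![C₀', C₁', C₂', c'] with hCf
  have hfu : ∀ k, ‖Cf k‖ = 1 := fun k => by fin_cases k <;> simp [hCf, hc', hC₀', hC₁', hC₂']
  have hcomm : ∀ μ ν : Fin 3, Cf (Fin.castSucc μ) * Cf (Fin.castSucc ν) = Cf (Fin.castSucc ν) * Cf (Fin.castSucc μ) := by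
    intro μ ν
    fin_cases μ <;> fin_cases ν
    all_goals simp [hCf]
    all_goals first | exact h01 | exact h02 | exact h12 | exact h01.symm | exact h02.symm | exact h12.symm
  have hflat := flat_of_sigma_relations (L := L) Cf hfu hcomm (by simp [hCf]; exact hs0) (by simp [hCf]; exact hs1) (by simp [hCf]; exact hs2)
  have hread : ∀ k, su2Quat (quatToSU2 (Cf k)) = Cf k := fun k => by
    have hne : Cf k ≠ 0 := by intro h0; have := hfu k; rw [h0, norm_zero] at this; exact zero_ne_one this
    rw [su2Quat_quatToSU2_eq_radialUnit hne, radialUnit_def, hfu k, inv_one, one_smul]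
  refine ⟨(fun k => quatToSU2 (Cf k), fun _ => 1), hflat, fun _ => rfl, fun μ => ?_, ?_⟩
  · show ‖C μ - su2Quat (quatToSU2 (Cf (Fin.castSucc μ)))‖ ≤ D + 4 * ε
    rw [hread]
    have hCμ : ‖C' μ - Cf (Fin.castSucc μ)‖ ≤ 4 * ε := by
      fin_cases μ
      · simpa [hCf] using hd0
      · simpa [hCf] using hd1
      · simpa [hCf] using hd2
    calc ‖C μ - Cf (Fin.castSucc μ)‖ = ‖(C μ - C' μ) + (C' μ - Cf (Fin.castSucc μ))‖ := by congr 1; abel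
      _ ≤ ‖C μ - C' μ‖ + ‖C' μ - Cf (Fin.castSucc μ)‖ := norm_add_le _ _
      _ ≤ D + 4 * ε := add_le_add (hdist' μ) hCμ
  · show ‖c - su2Quat (quatToSU2 (Cf 3))‖ ≤ 4 * ε
    rw [hread]
    simpa [hCf] using hdc

end Summit.QuantumFields.YangMills.Theorems.SwapVirialDeficit.NearFlat

end
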